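import Summits.Ventures.CertifiedManyBodySolver.Downfold.RouterWordScore

/-!
# The untyped-primary ceiling, the heavy-fermion threshold row, and the cur-1 g24 drafts: score-2's pre-registered
# router-word readings of 2026-08-28 13:4xZ (PREREG §E, by reference to Y87) as kernel facts of the §4.2 score

Venture CertifiedManyBodySolver, cell `pub/hubbard-downfold`, seat hubbard-downfold-score-2 (g15); namespace
`Summit.Ventures.CertifiedManyBodySolver.Downfold.RouterScore` (REUSES `outcome`, `score`, `Head`, `Outcome` and the property
sheet of `RouterWordScore.lean`; nothing new is defined). Context: the curator's successor shelf (validation/cur-1/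
v8-candidates-drafts-g24/, 2026-08-28 12:49Z / 13:15Z) holds five NEW validation-set v8 candidates with typed expected router
words — V8-186 LaIr₃ and V8-187 CeIr₃ (the RIr₃ trio with M376 ThIr₃), V8-188 SnMo₆S₈ (the tin Chevrel partner of M154
PbMo₆S₈), V8-189 NbIr₂B₂ / V8-190 TaIr₂B₂ (the 5d-Ir partners of M355 NbRh₂B₂ / M356 TaRh₂B₂). score-2 registered, BEFORE any
id, record, descriptor or word exists for them, what every plausible print SCORES under ACCEPTANCE §4.2 (v1.9 grammar) and
PRE-NAMED the at-risk shape per row (python twin: `validation/score/router/router_score.py` `outcome()`, sha16 c120bea11803846b,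
every case below checked there first).

* §1 TWO GENERAL FACTS of the score (any token type): `outcome_ne_agree_of_primary_untyped` — a print whose LEADING head is
  not the primary of any typed alternative never scores `AGREE`, whatever rides behind it (the payload-free CEILING at
  `PARTIAL` that every «pre-named straddle / comparator head» registration leans on); `outcome_eq_disagree_of_no_primary_emitted`
  — if, in addition, no typed primary occurs anywhere in the print (and the structure gate is closed), the cell is `DISAGREE`
  (the contrapositive of `primary_emitted_of_not_disagree`).
* §2 THE THRESHOLD ROW: CeIr₃ is typed «EPH | UND:HF-candidate+EPH». The A6-ii comparator spelling «UND:HF-candidate(…)»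
  (`other 1`, coded under v1.9 item 17) leading with EPH riding ⇒ `AGREE`; the A6-i Kondo-lattice head «UND:HF(…)» — the print
  of EVERY cerium row worded so far — ALONE ⇒ `DISAGREE`, with EPH riding ⇒ `PARTIAL`, and by §1 NEVER `AGREE` whatever rides:
  the router's w_f threshold between the two spellings decides the cell, registered before any descriptor exists.
* §3 the RIr₃ pair and the TT′₂B₂ quartet rows (typed «EPH | UND:MIXED+EPH») incl. the f⁰-lanthanum comparator shape
  «UND:HF-candidate(…)+UND:MIXED+EPH» (the La₄H₂₃ precedent) ⇒ `PARTIAL`; §4 the Chevrel pair (typed «EPH | UND:MULTIORB+EPH»)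
  with the Mo-4d straddle pre-named `PARTIAL`.

WHAT THIS IS NOT: not a word, not a prediction that any material prints these words, not a score of record (v8 rows are
written once at the lead's «v8 CLOSE», never pooled with the calibration R), and not physics. Material names appear only in
docstrings. Open-grammar heads are written `other n` (`other 1` = «UND:HF-candidate», as in `RouterWordScoreV8PreregLate.lean`);
descriptor payloads «(w_f = …)», «(RE-4f test …)», «(k; J_H)» annotate a head and do not change its token.
-/

namespace Summit.Ventures.CertifiedManyBodySolver.Downfold

namespace RouterScore

/-! ## §1 Two general facts: the untyped-primary ceiling and the no-primary floor -/

section general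

variable {α : Type*} [DecidableEq α] (structural : α → Bool)

/-- THE UNTYPED-PRIMARY CEILING. If the leading head `p` of the print is not the primary (head) of ANY typed alternative,
the cell never scores `AGREE` — whatever tokens ride behind `p`, whatever the alternatives' secondaries, and whether or not
the structure gate fires. (Every «pre-named straddle head» / «comparator head leading» registration is an instance: the
best such a print can do is `PARTIAL`.) [folklore] -/
theorem outcome_ne_agree_of_primary_untyped {p : α} {tl : List α} {alts : List (List α)}
    (h : ∀ a ∈ alts, a.head? ≠ some p) : outcome structural (p :: tl) alts ≠ .AGREE := by
  intro hA
  rw [outcome_cons] at hA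
  by_cases halts : alts = []
  · rw [if_pos halts] at hA; exact absurd hA (by decide)
  rw [if_neg halts] at hA
  by_cases hgate : (structural p && !expectsStructural structural alts) = true
  · rw [if_pos hgate] at hA; exact absurd hA (by decide)
  rw [if_neg hgate] at hA
  by_cases hm : alts.any (fullMatch (p :: tl)) = true
  · obtain ⟨a, ha, hfa⟩ := List.any_eq_true.1 hm
    simp only [fullMatch, Bool.and_eq_true, decide_eq_true_eq, List.head?_cons] at hfa
    exact h a ha hfa.1
  rw [if_neg hm] at hA
  by_cases hq : alts.any (primaryEmitted (p :: tl)) = true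
  · rw [if_pos hq] at hA; exact absurd hA (by decide)
  · rw [if_neg hq] at hA; exact absurd hA (by decide)

/-- THE NO-PRIMARY FLOOR. With an expectation registered and the structure gate closed, a print in which NO typed
alternative's primary occurs at all scores `DISAGREE` (contrapositive of `primary_emitted_of_not_disagree`). [folklore] -/
theorem outcome_eq_disagree_of_no_primary_emitted {p : α} {tl : List α} {alts : List (List α)}
    (halts : alts ≠ []) (hgate : (structural p && !expectsStructural structural alts) = false)
    (h : ∀ a ∈ alts, primaryEmitted (p :: tl) a = false) :
    outcome structural (p :: tl) alts = .DISAGREE := by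
  by_contra hne
  obtain ⟨a, ha, hpa⟩ := primary_emitted_of_not_disagree structural halts hgate hne
  rw [h a ha] at hpa
  exact Bool.false_ne_true hpa

end general

open Head

/-! ## §2 The threshold row: CeIr₃ typed «EPH | UND:HF-candidate+EPH» (PREREG §E 2026-08-28T13:4xZ) -/

/-- By §1, a print LED by the Kondo-lattice head «UND:HF(…)» can never score `AGREE` on the CeIr₃ row, whatever rides
behind it — the typed primaries are «EPH» and «UND:HF-candidate» (`other 1`) only. [folklore] -/
theorem ceir3_hf_led_never_agree (tl : List Head) : score (undHF :: tl) [[eph], [other 1, eph]] ≠ .AGREE :=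
  outcome_ne_agree_of_primary_untyped Head.structural (by decide)

/-- The CeIr₃ table registered before any descriptor: «EPH(+SA)» ⇒ AGREE; the A6-ii spelling «UND:HF-candidate(…)» leading
with EPH riding ⇒ AGREE whatever sits between head and EPH (the NdH₉ / PrBa₂Cu₃O₇ precedent shapes); PRE-NAMED at-risk shapes —
the A6-i head «UND:HF(w_f …; Kondo lattice)» ALONE (the print of every cerium row worded so far: CeCoIn₅, CeCu₂Si₂, CeH₉ ×2,
CeRhIn₅ ×2, CeIrIn₅ ×2, CePt₃Si) ⇒ DISAGREE; «UND:HF(…)+EPH» ⇒ PARTIAL; «UND:HF-candidate(…)» without EPH ⇒ PARTIAL; the Ir-5d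
straddle «UND:MIXED(…)+EPH» (typed on the La/Th members of the trio, NOT here) ⇒ PARTIAL; «UND:MULTIORB(k; J_H)+EPH» ⇒ PARTIAL;
an «UND:STRUCT…» primary ⇒ ABSTAIN_structure. [folklore] -/
theorem ceir3_threshold_table :
    score [eph, sa] [[eph], [other 1, eph]] = .AGREE
    ∧ score [other 1, eph] [[eph], [other 1, eph]] = .AGREE
    ∧ score [other 1, undMultiorb, eph] [[eph], [other 1, eph]] = .AGREE
    ∧ score [undHF] [[eph], [other 1, eph]] = .DISAGREE
    ∧ score [undHF, eph] [[eph], [other 1, eph]] = .PARTIAL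
    ∧ score [other 1] [[eph], [other 1, eph]] = .PARTIAL
    ∧ score [undMixed, eph] [[eph], [other 1, eph]] = .PARTIAL
    ∧ score [undMultiorb, eph] [[eph], [other 1, eph]] = .PARTIAL
    ∧ score [undStruct, eph] [[eph], [other 1, eph]] = .ABSTAIN_structure := by decide

/-- The same Kondo-lattice print on the rows where «UND:HF» IS the typed primary (the cerium calibration / v2 rows) scores
AGREE — the CeIr₃ DISAGREE above is made by the curator's typed letter for an intermediate-valence 3-K superconductor, not by
the scorer. [folklore] -/
theorem hf_print_on_hf_typed_rows : score [undHF] [[undHF]] = .AGREE ∧ score [undHF] [[eph], [other 1, eph]] = .DISAGREE := by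
  decide

/-! ## §3 The RIr₃ pair and the TT′₂B₂ quartet rows, typed «EPH | UND:MIXED+EPH» -/

/-- LaIr₃ (V8-186; = ThIr₃ M376) and NbIr₂B₂ / TaIr₂B₂ (V8-189 / V8-190; = NbRh₂B₂ M355 / TaRh₂B₂ M356): «EPH(+SA)» and the
d-manifold straddle «UND:MIXED(…)+EPH» ⇒ AGREE; PRE-NAMED at-risk shapes — the f⁰-lanthanum A6-ii comparator head leading,
«UND:HF-candidate(RE-4f test …)+UND:MIXED+EPH» (the La₄H₂₃ M287 print shape) ⇒ PARTIAL (and never AGREE by §1);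
«UND:MULTIORB(k; J_H)+EPH» ⇒ PARTIAL; «UND:MIXED» without EPH ⇒ PARTIAL; «UND:LATTICE(…)+EPH» primary ⇒ PARTIAL while the
EPH-led «EPH+UND:LATTICE» ⇒ AGREE; an «UND:STRUCT…» primary ⇒ ABSTAIN_structure. [folklore] -/
theorem v8g15_pair_typed :
    score [eph, sa] [[eph], [undMixed, eph]] = .AGREE ∧ score [undMixed, eph] [[eph], [undMixed, eph]] = .AGREE
    ∧ score [other 1, undMixed, eph] [[eph], [undMixed, eph]] = .PARTIAL
    ∧ score [undMultiorb, eph] [[eph], [undMixed, eph]] = .PARTIAL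
    ∧ score [undMixed] [[eph], [undMixed, eph]] = .PARTIAL
    ∧ score [undLattice, eph] [[eph], [undMixed, eph]] = .PARTIAL
    ∧ score [eph, undLattice] [[eph], [undMixed, eph]] = .AGREE
    ∧ score [undStruct, eph] [[eph], [undMixed, eph]] = .ABSTAIN_structure := by decide

/-- The comparator-led shape can never AGREE on these rows whatever rides (§1 instance: `other 1` is not a typed primary of
«EPH | UND:MIXED+EPH»). [folklore] -/
theorem v8g15_comparator_led_never_agree (tl : List Head) :
    score (other 1 :: tl) [[eph], [undMixed, eph]] ≠ .AGREE :=
  outcome_ne_agree_of_primary_untyped Head.structural (by decide)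

/-! ## §4 The Chevrel pair, typed «EPH | UND:MULTIORB+EPH» -/

/-- SnMo₆S₈ (V8-188; = PbMo₆S₈ M154, unworded): «EPH(+SA)» and the Mo₆-cluster manifold head «UND:MULTIORB(k; J_H)+EPH» ⇒
AGREE; PRE-NAMED at-risk shapes — the Mo-4d R3c straddle «UND:MIXED(…)+EPH» (the Mo₃Al₂C M332 print) ⇒ PARTIAL; «UND:MULTIORB»
without EPH ⇒ PARTIAL; «UND:MIXED» alone ⇒ DISAGREE; «UND:LATTICE(Einstein cation mode)+EPH» primary ⇒ PARTIAL; an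
«UND:STRUCT…» primary (the low-temperature triclinic question of the Chevrels) ⇒ ABSTAIN_structure. [folklore] -/
theorem v8g15_chevrel :
    score [eph, sa] [[eph], [undMultiorb, eph]] = .AGREE ∧ score [undMultiorb, eph] [[eph], [undMultiorb, eph]] = .AGREE
    ∧ score [undMixed, eph] [[eph], [undMultiorb, eph]] = .PARTIAL
    ∧ score [undMultiorb] [[eph], [undMultiorb, eph]] = .PARTIAL
    ∧ score [undMixed] [[eph], [undMultiorb, eph]] = .DISAGREE
    ∧ score [undLattice, eph] [[eph], [undMultiorb, eph]] = .PARTIAL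
    ∧ score [undStruct, eph] [[eph], [undMultiorb, eph]] = .ABSTAIN_structure := by decide

/-! ## §5 The prints of 13:05Z against their registrations -/

/-- M219 PbTe:Tl x = 0.014 and M239 PbTe:Na x = 0.006 (boxes of record #227 / #228, both «EPH» on «EPH»-typed rows; the
doped-covalent and control notes of g12/g13) ⇒ AGREE ×2 — the MO-PRED tally's 1st and 2nd counted rows after the 1.7 cut.
[folklore] -/
theorem v8g15_prints_pbte : score [eph] [[eph]] = .AGREE := by decide

/-! ## §6 (appended 2026-08-28T14:3xZ) The two-polymorph KEY ROW of the lead's ruling R-lp (ii) and its member sub-rows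

Box of record #229 (M280 PrH₉ @120 GPa, 14:13Z) is the first material booked under the lead's two-polymorph rule R-lp (ii)
(fixed 03:43Z before any number): when the two polymorph anchors print DIFFERENT primaries, the material's KEY row in WORDS.tsv
is a declaration led by «UND:STRUCT(two-polymorph declaration …)» followed by the common tail, and the two polymorph words are
written as MEMBER sub-rows (ids M280a / M280b) that have NO truth file — they are not cells of any score (the scorer of record
reads one router word per map, i.e. per truth id; score-2's ledger tool defers them under the parent, PREREG §E 14:2xZ).
The class consequence is registered here for every later two-polymorph row. -/

/-- THE R-lp (ii) CLASS CONSEQUENCE: a key row led by a STRUCTURAL head scores `ABSTAIN_structure` against ANY registered set of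
alternatives none of which has a structural PRIMARY — whatever tail the declaration carries (instance of
`outcome_structural_abstain`; «EPH+UND:STRUCT» carries STRUCT as a secondary and does not open the gate). [folklore] -/
theorem two_polymorph_keyrow_abstains (tl : List Head) (alts : List (List Head)) (halts : alts ≠ [])
    (hexp : expectsStructural Head.structural alts = false) :
    score (undStruct :: tl) alts = .ABSTAIN_structure :=
  outcome_structural_abstain Head.structural halts rfl hexp

/-- M280 PrH₉ @120 as printed (typed «EPH | EPH+UND:STRUCT | UND:HF-candidate+EPH | UND:MULTIORB+EPH»): the KEY row
«UND:STRUCT(two-polymorph declaration …)+UND:HF-candidate(RE-4f …)+EPH» ⇒ ABSTAIN_structure (honestly NOT a shape score-2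
pre-named for this material — it follows the lead's rule); the MEMBER previews against the parent's typed words — hexagonal
«UND:MIXED(m …)+UND:HF-candidate(…)+EPH+UND:MULTIORB(k=5; J_H)» ⇒ PARTIAL (the pre-named straddle-led shape), cubic
«UND:HF-candidate(…)+EPH» ⇒ AGREE (pre-named) — previews only, never cells. Had the curators typed «UND:STRUCT+EPH» as a
PRIMARY alternative for this column, the same key row would score AGREE. [folklore] -/
theorem v8g15_prh9_two_polymorph :
    score [undStruct, other 1, eph] [[eph], [eph, undStruct], [other 1, eph], [undMultiorb, eph]] = .ABSTAIN_structure
    ∧ score [undMixed, other 1, eph, undMultiorb] [[eph], [eph, undStruct], [other 1, eph], [undMultiorb, eph]] = .PARTIAL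
    ∧ score [other 1, eph] [[eph], [eph, undStruct], [other 1, eph], [undMultiorb, eph]] = .AGREE
    ∧ score [undStruct, other 1, eph] [[eph], [undStruct, eph], [other 1, eph], [undMultiorb, eph]] = .AGREE := by decide

end RouterScore

end Summit.Ventures.CertifiedManyBodySolver.Downfold
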